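import Literature.AlgebraicGeometry.Resolution.AlterationsNodalFibre
import Literature.AlgebraicGeometry.Resolution.RegularLocusPerfectField
import Literature.AlgebraicGeometry.Resolution.SmoothLocusBaseChange
import Mathlib.RingTheory.Smooth.Fiber
import Mathlib.RingTheory.TensorProduct.Quotient
import HarnessLib

/-!
# Flat with a regular fibre over a perfect residue field ⇒ smooth; a point of `Sing(f)` of the
# curve of Situation 4.23 is a singular point of its fibre (de Jong 1996, 2.23; EGA IV₄ 17.5.1)

Topic: `Literature/AlgebraicGeometry/Resolution`. De Jong 1996, 2.23 starts from a point
`x ∈ Sing(f)` of a semi-stable curve `f : X → S` and uses at once that `x` is a singular point of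
its FIBRE: "By assumption of semi-stability we have that `B/𝔪_A B ≅ k'⟦u, v⟧/(q)`". The passage
from "`f` is not smooth at `x`" to "the fibre `X_{f x}` is not smooth (= not regular, over the
algebraically closed residue field) at `x`" is the fibrewise criterion of smoothness (EGA IV₄
17.5.1; The Stacks Project, Tag 01V8: "Let `f : X → S` be a morphism of schemes. Let `x ∈ X` …
Assume `f` is locally of finite presentation, `f` is flat at `x`, and the fibre `X_{f(x)}` is
smooth at `x`. Then `f` is smooth at `x`"; Tag 00TF for rings). Mathlib has the local algebra
form `Algebra.FormallySmooth.of_formallySmooth_residueField_tensor` (a flat local algebra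
essentially of finite presentation whose fibre ring `κ ⊗_R S` is formally smooth over `κ` is
formally smooth) and this tree has "regular ⇒ smooth over a perfect field"
(`isSmoothAt_iff_isRegularLocalRing_of_perfectField`, `RegularLocusPerfectField.lean`). This file
PROVES the combination, in three layers:

* `formallySmooth_of_isRegularLocalRing_of_perfectField` — a regular local ring essentially of
  finite type over a perfect field `k` is formally smooth over `k` (the local ring is `B_𝔮` for
  a finitely generated `B`; Stacks 00TV);
* `formallySmooth_of_flat_of_isRegularLocalRing_fiber` — **Stacks 00TF/01V8, regular-fibre
  form**: a flat local algebra `S`, essentially of finite type over a Noetherian local ring `R`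
  with perfect residue field `κ`, whose fibre ring `κ ⊗_R S` is a regular local ring, is formally
  smooth over `R`;
* `mem_smoothLocus_of_isRegularLocalRing_stalk_fiber` — for `f : X → Y` flat and locally of
  finite presentation over a locally Noetherian `Y`, a point `x` with perfect `κ(f x)` at which
  the fibre `X_{f x}` has a regular local ring lies in the smooth locus `sm(X/Y)` of `f` (the local
  ring of the fibre is `𝒪_{X,x}/𝔪_{f x}𝒪_{X,x}`,
  `Literature.AlgebraicGeometry.Motives.nonempty_stalkFiber_ringEquiv_asFiber`);
* whence, for the curve `f : X → Y` of a pair in Situation 4.23 over an algebraically closed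
  field (`DeJong1996.SemiStablePair`), at a closed point `x` lying in no open on which `f` is
  smooth, the fibre is NOT regular at `x`
  (`DeJong1996.SemiStablePair.not_isRegularLocalRing_stalk_fiber_of_not_smooth`), so that the
  third input of 2.23 proved in `AlterationsNodalFibre.lean` applies: the completion of
  `𝒪_{X,x}/𝔪_{f x}𝒪_{X,x}` is `κ(f x)⟦u, v⟧/(uv)`
  (`DeJong1996.SemiStablePair.nonempty_ringEquiv_fibreCompletion_of_not_smooth`).

## Sources

* A. Grothendieck, J. Dieudonné, *EGA IV₄*, Publ. Math. IHÉS 32 (1967), Thm. 17.5.1.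
* The Stacks Project, Tags 00TF, 00TV, 01V8.
* A. J. de Jong, *Smoothness, semi-stability and alterations*, Publ. Math. IHÉS 83 (1996), 2.23,
  pp. 61–62.
-/

noncomputable section

open CategoryTheory CategoryTheory.Limits AlgebraicGeometry TopologicalSpace IsLocalRing
  TensorProduct

namespace Literature.AlgebraicGeometry.Resolution

universe u

/-! ## Regular local rings essentially of finite type over a perfect field are formally smooth -/

/-- **A regular local ring essentially of finite type over a perfect field is formally smooth
over it** (The Stacks Project, Tag 00TV with `κ(𝔮)/k` separable, which is automatic over a
perfect field; Matsumura §30 Remark 2). The ring is `B_𝔮` for the finitely generated subalgebra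
`B` of which it is a localization (`Algebra.EssFiniteType.subalgebra`) and the contraction `𝔮` of
its maximal ideal, so `isSmoothAt_iff_isRegularLocalRing_of_perfectField` applies.
[cite: StacksProject, Tag 00TV] -/
theorem formallySmooth_of_isRegularLocalRing_of_perfectField (k A : Type u) [Field k]
    [PerfectField k] [CommRing A] [Algebra k A] [Algebra.EssFiniteType k A]
    [IsRegularLocalRing A] : Algebra.FormallySmooth k A := by
  -- `A` is a localization of the finitely generated subalgebra `B`
  let B : Subalgebra k A := Algebra.EssFiniteType.subalgebra k A
  let M : Submonoid B := (IsUnit.submonoid A).comap (algebraMap B A)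
  haveI hM : IsLocalization M A := Algebra.EssFiniteType.isLocalization k A
  -- the contraction of the maximal ideal
  let q : Ideal B := (maximalIdeal A).comap (algebraMap B A)
  haveI hq : q.IsPrime := Ideal.comap_isPrime _ _
  -- `M` is the complement of `q`, so `A = B_q`
  have hMq : M = q.primeCompl := by
    ext b
    simp only [M, q, Submonoid.mem_comap, IsUnit.mem_submonoid_iff, Ideal.mem_primeCompl_iff,
      Ideal.mem_comap, mem_maximalIdeal, mem_nonunits_iff, not_not]
  haveI : IsLocalization q.primeCompl A := by rw [← hMq]; exact hM
  let e : Localization.AtPrime q ≃ₐ[B] A :=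
    IsLocalization.algEquiv q.primeCompl (Localization.AtPrime q) A
  haveI : IsRegularLocalRing (Localization.AtPrime q) :=
    IsRegularLocalRing.of_ringEquiv e.toRingEquiv.symm
  have hsm : Algebra.IsSmoothAt k q :=
    (isSmoothAt_iff_isRegularLocalRing_of_perfectField k B q).mpr inferInstance
  exact Algebra.FormallySmooth.of_equiv (e.restrictScalars k)

/-! ## Stacks 00TF / 01V8 with a regular fibre -/

/-- **Flat with regular fibre over a perfect residue field ⇒ formally smooth** (The Stacks
Project, Tag 00TF/01V8; EGA IV₄ 17.5.1, in the regular-fibre form). Let `(R, 𝔪, κ)` be a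
Noetherian local ring with perfect residue field, `S` a local `R`-algebra essentially of finite
type, flat, with `R → S` local, whose fibre ring `κ ⊗_R S` is a regular local ring. Then `S` is
formally smooth over `R`: the fibre ring is essentially of finite type over the perfect `κ`,
hence formally smooth over `κ` (`formallySmooth_of_isRegularLocalRing_of_perfectField`), and
Mathlib's `Algebra.FormallySmooth.of_formallySmooth_residueField_tensor` (flat + formally
smooth fibre + essentially of finite presentation ⇒ formally smooth) applies, `S` being a
localization of a finitely generated, hence — `R` Noetherian — finitely presented subalgebra.
[cite: StacksProject, Tag 00TF] -/
theorem formallySmooth_of_flat_of_isRegularLocalRing_fiber (R S : Type u) [CommRing R]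
    [CommRing S] [Algebra R S] [IsLocalRing R] [IsLocalRing S] [IsLocalHom (algebraMap R S)]
    [IsNoetherianRing R] [Algebra.EssFiniteType R S] [Module.Flat R S]
    [PerfectField (ResidueField R)] (hreg : IsRegularLocalRing (ResidueField R ⊗[R] S)) :
    Algebra.FormallySmooth R S := by
  haveI := hreg
  haveI : Algebra.FormallySmooth (ResidueField R) (ResidueField R ⊗[R] S) :=
    formallySmooth_of_isRegularLocalRing_of_perfectField (ResidueField R) (ResidueField R ⊗[R] S)
  -- `S` is a localization of the finitely presented subalgebra `P`
  let P : Subalgebra R S := Algebra.EssFiniteType.subalgebra R S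
  let M : Submonoid P := (IsUnit.submonoid S).comap (algebraMap P S)
  haveI hM : IsLocalization M S := Algebra.EssFiniteType.isLocalization R S
  haveI : Algebra.FinitePresentation R P :=
    (Algebra.FinitePresentation.of_finiteType (R := R) (A := P)).mp inferInstance
  exact Algebra.FormallySmooth.of_formallySmooth_residueField_tensor (R := R) (S := S) (P := P) M

/-! ## Scheme level: a regular point of the fibre of a flat morphism is a smooth point -/

/-- **A point at which the fibre is regular lies in the smooth locus** (EGA IV₄ 17.5.1 / Stacks
01V8, regular-fibre form): `f : X → Y` flat and locally of finite presentation, `Y` locally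
Noetherian, `x ∈ X` with `κ(f x)` perfect and `𝒪_{X_{f x}, x}` a regular local ring; then
`x ∈ sm(X/Y)` (Mathlib `Scheme.Hom.smoothLocus`: the stalk map `𝒪_{Y,f x} → 𝒪_{X,x}` is formally
smooth). The local ring of the fibre is `𝒪_{X,x}/𝔪_{f x}𝒪_{X,x} ≅ κ(f x) ⊗ 𝒪_{X,x}`
(`Literature.AlgebraicGeometry.Motives.nonempty_stalkFiber_ringEquiv_asFiber`), to which
`formallySmooth_of_flat_of_isRegularLocalRing_fiber` applies. [cite: StacksProject, Tag 01V8] -/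
theorem mem_smoothLocus_of_isRegularLocalRing_stalk_fiber {X Y : Scheme.{u}} (f : X ⟶ Y)
    [LocallyOfFinitePresentation f] [Flat f] [IsLocallyNoetherian Y] (x : X)
    [PerfectField (Y.residueField (f x))]
    (hreg : IsRegularLocalRing ((f.fiber (f x)).presheaf.stalk (f.asFiber x))) :
    x ∈ f.smoothLocus := by
  set R := Y.presheaf.stalk (f x) with hR
  set S := X.presheaf.stalk x with hS
  letI : Algebra R S := (f.stalkMap x).hom.toAlgebra
  haveI : IsLocalHom (algebraMap R S) := inferInstanceAs (IsLocalHom (f.stalkMap x).hom)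
  haveI : Algebra.EssFiniteType R S := LocallyOfFiniteType.stalkMap f x
  haveI : Module.Flat R S := Flat.stalkMap f x
  haveI : PerfectField (ResidueField R) := inferInstanceAs (PerfectField (Y.residueField (f x)))
  -- the fibre ring `κ ⊗ S ≅ S/𝔪_R S ≅ 𝒪_{X_{f x}, x}` is regular
  obtain ⟨e₀⟩ := Literature.AlgebraicGeometry.Motives.nonempty_stalkFiber_ringEquiv_asFiber f x
  have e₁ : (S ⧸ (maximalIdeal R).map (algebraMap R S)) ≃+* ResidueField R ⊗[R] S :=
    (Algebra.TensorProduct.quotIdealMapEquivTensorQuot S (maximalIdeal R)).toRingEquiv.trans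
      (Algebra.TensorProduct.comm R S (ResidueField R)).toRingEquiv
  haveI := hreg
  have hreg' : IsRegularLocalRing (ResidueField R ⊗[R] S) :=
    IsRegularLocalRing.of_ringEquiv (e₀.trans e₁)
  have hfs : Algebra.FormallySmooth R S :=
    formallySmooth_of_flat_of_isRegularLocalRing_fiber R S hreg'
  rw [Scheme.Hom.mem_smoothLocus]
  exact hfs

/-! ## The curve of Situation 4.23: a point of `Sing(f)` is a singular point of its fibre -/

namespace DeJong1996.SemiStablePair

variable {k : Type u} [Field k] {X Y : Scheme.{u}} {f : X ⟶ Y} {g : Y ⟶ Spec (.of k)}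
  {D : Set Y} {n : ℕ} {τ : Fin n → (Y ⟶ X)}

/-- **A closed point of `Sing(f)` is a singular point of its fibre.** For the curve `f : X → Y`
of a pair in Situation 4.23 over an algebraically closed field and a closed point `x` lying in
no open on which `f` is smooth, the local ring of the fibre `X_{f x}` at `x` is not regular
(`κ(f x) = k` is perfect, `f` is flat and of finite presentation, so a regular fibre would put
`x` in the open smooth locus, `mem_smoothLocus_of_isRegularLocalRing_stalk_fiber`).
[cite: StacksProject, Tag 01V8] -/
theorem not_isRegularLocalRing_stalk_fiber_of_not_smooth [IsAlgClosed k]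
    (hS : SemiStablePair f g D τ) {x : X} (hx : IsClosed ({x} : Set X))
    (hns : ∀ U : X.Opens, x ∈ U → ¬ Smooth (U.ι ≫ f)) :
    ¬ IsRegularLocalRing ((f.fiber (f x)).presheaf.stalk (f.asFiber x)) := by
  intro hreg
  haveI := hS.isSemiStableCurve.flat
  haveI := hS.isSemiStableCurve.locallyOfFinitePresentation
  haveI := hS.isNoetherian_base
  haveI : IsProper g :=
    Literature.AlgebraicGeometry.Motives.IsProjectiveOver.isProper (X := Over.mk g)
      hS.isProjectiveOver_base
  haveI : IsAlgClosed (Y.residueField (f x)) :=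
    IsAlgClosed.of_ringEquiv k _
      (residueFieldIsoBase g (f x) (hS.isClosed_image hx)).commRingCatIsoToRingEquiv.symm
  have hx' : x ∈ f.smoothLocus := mem_smoothLocus_of_isRegularLocalRing_stalk_fiber f x hreg
  obtain ⟨V, hxV, hV⟩ := exists_smooth_ι_comp_of_mem_smoothLocus f hx'
  exact hns V hxV hV

/-- **de Jong 1996, 2.23, third input at a point of `Sing(f)`: "By assumption of
semi-stability we have that `B/𝔪_A B ≅ k'⟦u, v⟧/(q)` … we may choose `q = uv`."** For the curve
of a pair in Situation 4.23 over an algebraically closed field and a closed point `x` lying in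
no open on which `f` is smooth, the completion of `𝒪_{X,x}/𝔪_{f x}𝒪_{X,x}` (at the image of
`𝔪_x`) is `κ(f x)⟦u, v⟧/(uv)` (`nonempty_ringEquiv_fibreCompletion` of
`AlterationsNodalFibre.lean`, whose singularity hypothesis is
`not_isRegularLocalRing_stalk_fiber_of_not_smooth`). [cite: DeJong1996, 2.23, pp. 61–62] -/
theorem nonempty_ringEquiv_fibreCompletion_of_not_smooth [IsAlgClosed k]
    (hS : SemiStablePair f g D τ) {x : X} (hx : IsClosed ({x} : Set X))
    (hns : ∀ U : X.Opens, x ∈ U → ¬ Smooth (U.ι ≫ f)) :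
    Nonempty (AdicCompletion
        ((maximalIdeal (X.presheaf.stalk x)).map (Ideal.Quotient.mk
          ((maximalIdeal (Y.presheaf.stalk (f x))).map (f.stalkMap x).hom)))
        (X.presheaf.stalk x ⧸ (maximalIdeal (Y.presheaf.stalk (f x))).map (f.stalkMap x).hom) ≃+*
      (MvPowerSeries (Fin 2) (ResidueField (Y.presheaf.stalk (f x))) ⧸
        Ideal.span {(MvPowerSeries.X 0 * MvPowerSeries.X 1 :
          MvPowerSeries (Fin 2) (ResidueField (Y.presheaf.stalk (f x))))})) :=
  hS.nonempty_ringEquiv_fibreCompletion hx (hS.not_isRegularLocalRing_stalk_fiber_of_not_smooth hx hns)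

end DeJong1996.SemiStablePair

end Literature.AlgebraicGeometry.Resolution

end
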